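import Mathlib
import Summits.Ventures.PercRepro2.GenTailComp
import Summits.Ventures.PercRepro2.CutSplit
import Summits.Ventures.PercRepro2.IteratedBKDual

/-!
# Row B2* on series–parallel compositions of blocks of terminal distance ≤ 2
(seat mine-b, cell pub-perc-repro2)

The path-dual row B2* (MINE-B.md §8.2): `D ≥ k` iff the closed edges contain `k` pairwise
disjoint `s–t` cuts (`cutEvent`, IteratedBKDual.lean), and the claim is that `k ↦ P(D ≥ k)` is
log-concave.  `CutNet ends s t E₀` is the class of two-terminal networks generated from parts that
carry `s` to `t` and admit no three pairwise disjoint cuts (`atom` — e.g. parts in which `s` and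
`t` are adjacent or have a common neighbour, `CutNet.atom_of_edge` / `CutNet.atom_of_path2`) by
parallel composition (`D = min(D₁, D₂)`, MIN-type) and series composition (`D = D₁ + D₂`,
SUM-type).  With the engine of `GenTail.lean` / `GenTailComp.lean` applied in the complementary
configuration (`compl`, vector `1 − p`) and the cut-splitting lemmas of `CutSplit.lean`, every
network of the class has a log-concave cut tail (`CutNet.isLCTail`), so **row B2* holds for every
product measure on every graph of the class** (`cut_logconcave_of_CutNet`): every series–parallel
graph, `K₅ − st` and every block in which the terminals have a common neighbour, and all their
series/parallel compositions.  `LCNet.lean` is the twin statement for row B2 (max-flow).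
-/

open Finset

namespace Summit.Ventures.PercRepro2

open IFR

variable {V : Type*} {E : Type*} [Fintype E] [DecidableEq E]

/-- **`D₁ ≥ k` inside a part**: the closed edges of `E₁` contain `k` pairwise disjoint cuts of `E₁` -/
def cutIn (ends : E → Sym2 V) (s t : V) (E₁ : Finset E) (k : ℕ) : Set (Config E) :=
  {ω | kDisj (fun S => SeparatesIn ends E₁ S s t) k (closedSet ω ∩ E₁)}

/-- the cut event is the packing event of the complementary configuration -/
lemma cutIn_eq_preimage (ends : E → Sym2 V) (s t : V) (E₁ : Finset E) (k : ℕ) :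
    cutIn ends s t E₁ k = {ω | compl ω ∈ genIn (fun S => SeparatesIn ends E₁ S s t) E₁ k} := by
  ext ω
  simp only [cutIn, genIn, Set.mem_setOf_eq, closedSet_eq_openSet_compl]

/-- the probability of the cut event is the packing probability for the vector `1 − p` -/
lemma prob_cutIn (p : E → ℝ) (ends : E → Sym2 V) (s t : V) (E₁ : Finset E) (k : ℕ) :
    prob p (cutIn ends s t E₁ k)
      = prob (fun e => 1 - p e) (genIn (fun S => SeparatesIn ends E₁ S s t) E₁ k) := by
  rw [cutIn_eq_preimage, prob_preimage_compl]

/-- on the whole edge set the cut event is `cutEvent` (`D ≥ k`) -/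
lemma cutIn_univ (ends : E → Sym2 V) (s t : V) (k : ℕ) :
    cutIn ends s t Finset.univ k = cutEvent ends s t k := by
  ext ω
  simp only [cutIn, cutEvent, Set.mem_setOf_eq, Finset.inter_univ]
  rfl

/-- **two-terminal networks with log-concave cut packing by construction**: parts carrying the
terminals with no three disjoint cuts (`atom`), closed under parallel composition of parts sharing
only the terminals (`par`) and series composition of parts sharing only a cut vertex (`ser`). -/
inductive CutNet (ends : E → Sym2 V) : V → V → Finset E → Prop
  | atom {s t : V} {E₁ : Finset E} (hst : s ≠ t) (hc : Carries ends E₁ s t)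
      (h3 : genIn (fun S => SeparatesIn ends E₁ S s t) E₁ 3 = ∅) : CutNet ends s t E₁
  | par {s t : V} {E₁ E₂ : Finset E} (hst : s ≠ t) (hE : SharesOnlyTerminals ends s t E₁ E₂)
      (hd : Disjoint E₁ E₂) (h₁ : CutNet ends s t E₁) (h₂ : CutNet ends s t E₂) :
      CutNet ends s t (E₁ ∪ E₂)
  | ser {s v t : V} {E₁ E₂ : Finset E} (hE : SharesOnlyVertex ends v E₁ E₂)
      (hs : ∀ e ∈ E₂, s ∉ ends e) (ht : ∀ e ∈ E₁, t ∉ ends e) (hsv : s ≠ v) (htv : t ≠ v)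
      (hst : s ≠ t) (hd : Disjoint E₁ E₂) (h₁ : CutNet ends s v E₁) (h₂ : CutNet ends v t E₂) :
      CutNet ends s t (E₁ ∪ E₂)

/-- the terminals of a network are distinct -/
theorem CutNet.ne {ends : E → Sym2 V} {s t : V} {E₀ : Finset E} (h : CutNet ends s t E₀) : s ≠ t := by
  cases h with
  | atom hst _ _ => exact hst
  | par hst _ _ _ _ => exact hst
  | ser _ _ _ _ _ hst _ _ _ => exact hst

/-- every network carries its terminals -/
theorem CutNet.carries {ends : E → Sym2 V} {s t : V} {E₀ : Finset E} (h : CutNet ends s t E₀) :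
    Carries ends E₀ s t := by
  induction h with
  | atom _ hc _ => exact hc
  | par _ _ _ _ _ ih₁ _ => exact Carries.mono Finset.subset_union_left ih₁
  | ser _ _ _ _ _ _ _ _ _ ih₁ ih₂ => exact carries_union_trans ih₁ ih₂

omit [Fintype E] in
/-- a separator of a part contains every edge of the part joining the terminals -/
lemma mem_of_separatesIn {ends : E → Sym2 V} {E₁ S : Finset E} {s t : V} {e : E} (he : e ∈ E₁)
    (hends : ends e = s(s, t)) (hS : SeparatesIn ends E₁ S s t) : e ∈ S := by
  by_contra hnot
  apply hS
  exact conn_of_openAdj ⟨e, ofFinset_eq_true_iff.2 (Finset.mem_sdiff.2 ⟨he, hnot⟩), hends⟩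

omit [Fintype E] in
/-- a separator of a part contains one of the two edges of a path of length two between the terminals -/
lemma mem_or_mem_of_separatesIn {ends : E → Sym2 V} {E₁ S : Finset E} {s x t : V} {e₁ e₂ : E}
    (he₁ : e₁ ∈ E₁) (he₂ : e₂ ∈ E₁) (h₁ : ends e₁ = s(s, x)) (h₂ : ends e₂ = s(x, t))
    (hS : SeparatesIn ends E₁ S s t) : e₁ ∈ S ∨ e₂ ∈ S := by
  by_contra hnot
  rw [not_or] at hnot
  apply hS
  exact conn_trans
    (conn_of_openAdj ⟨e₁, ofFinset_eq_true_iff.2 (Finset.mem_sdiff.2 ⟨he₁, hnot.1⟩), h₁⟩)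
    (conn_of_openAdj ⟨e₂, ofFinset_eq_true_iff.2 (Finset.mem_sdiff.2 ⟨he₂, hnot.2⟩), h₂⟩)

/-- **adjacent terminals**: a part containing an edge joining `s` and `t` is an atom -/
theorem CutNet.atom_of_edge {ends : E → Sym2 V} {s t : V} (hst : s ≠ t) {E₁ : Finset E} {e : E}
    (he : e ∈ E₁) (hends : ends e = s(s, t)) : CutNet ends s t E₁ := by
  refine CutNet.atom hst (conn_of_openAdj ⟨e, ofFinset_eq_true_iff.2 he, hends⟩) ?_
  apply Set.eq_empty_of_subset_empty
  intro ω hω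
  obtain ⟨K, L, _, _, hKL, hA, hB⟩ := hω
  obtain ⟨K', _, hK', _, _, hA', _⟩ := hB L le_rfl
  have h1 := mem_of_separatesIn he hends (hA K le_rfl)
  have h2 := mem_of_separatesIn he hends (hA' K' le_rfl)
  exact Finset.disjoint_left.1 hKL h1 (hK' h2)

/-- **a common neighbour**: a part containing a path `s – x – t` of length two is an atom -/
theorem CutNet.atom_of_path2 {ends : E → Sym2 V} {s x t : V} (hst : s ≠ t) {E₁ : Finset E} {e₁ e₂ : E}
    (he₁ : e₁ ∈ E₁) (he₂ : e₂ ∈ E₁) (h₁ : ends e₁ = s(s, x)) (h₂ : ends e₂ = s(x, t)) :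
    CutNet ends s t E₁ := by
  refine CutNet.atom hst (conn_trans (conn_of_openAdj ⟨e₁, ofFinset_eq_true_iff.2 he₁, h₁⟩)
    (conn_of_openAdj ⟨e₂, ofFinset_eq_true_iff.2 he₂, h₂⟩)) ?_
  apply Set.eq_empty_of_subset_empty
  intro ω hω
  obtain ⟨K, L, _, _, hKL, hA, hB⟩ := hω
  obtain ⟨K', L', hK', hL', hKL', hA', hB'⟩ := hB L le_rfl
  obtain ⟨K'', _, hK'', _, _, hA'', _⟩ := hB' L' le_rfl
  have d1 : Disjoint K K' := Finset.disjoint_of_subset_right hK' hKL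
  have d2 : Disjoint K K'' := Finset.disjoint_of_subset_right (hK''.trans hL') hKL
  have d3 : Disjoint K' K'' := Finset.disjoint_of_subset_right hK'' hKL'
  have m1 := mem_or_mem_of_separatesIn he₁ he₂ h₁ h₂ (hA K le_rfl)
  have m2 := mem_or_mem_of_separatesIn he₁ he₂ h₁ h₂ (hA' K' le_rfl)
  have m3 := mem_or_mem_of_separatesIn he₁ he₂ h₁ h₂ (hA'' K'' le_rfl)
  rcases m1 with a1 | b1 <;> rcases m2 with a2 | b2 <;> rcases m3 with a3 | b3
  · exact Finset.disjoint_left.1 d1 a1 a2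
  · exact Finset.disjoint_left.1 d1 a1 a2
  · exact Finset.disjoint_left.1 d2 a1 a3
  · exact Finset.disjoint_left.1 d3 b2 b3
  · exact Finset.disjoint_left.1 d3 a2 a3
  · exact Finset.disjoint_left.1 d2 b1 b3
  · exact Finset.disjoint_left.1 d1 b1 b2
  · exact Finset.disjoint_left.1 d1 b1 b2

/-- the parallel split in the language of `genIn` -/
lemma genIn_sep_par_iff {ends : E → Sym2 V} {s t : V} (hst : s ≠ t) {E₁ E₂ : Finset E}
    (hE : SharesOnlyTerminals ends s t E₁ E₂) (hd : Disjoint E₁ E₂) (k : ℕ) (ω : Config E) :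
    ω ∈ genIn (fun S => SeparatesIn ends (E₁ ∪ E₂) S s t) (E₁ ∪ E₂) k ↔
      ω ∈ genIn (fun S => SeparatesIn ends E₁ S s t) E₁ k ∧
        ω ∈ genIn (fun S => SeparatesIn ends E₂ S s t) E₂ k := by
  have h1 : openSet ω ∩ (E₁ ∪ E₂) ∩ E₁ = openSet ω ∩ E₁ := by
    ext e; simp only [Finset.mem_inter, Finset.mem_union]; tauto
  have h2 : openSet ω ∩ (E₁ ∪ E₂) ∩ E₂ = openSet ω ∩ E₂ := by
    ext e; simp only [Finset.mem_inter, Finset.mem_union]; tauto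
  simp only [genIn, Set.mem_setOf_eq]
  rw [kDisj_sep_par_iff hst hE hd k Finset.inter_subset_right, h1, h2]

/-- the series split in the language of `genIn` -/
lemma genIn_sep_ser_iff {ends : E → Sym2 V} {s v t : V} {E₁ E₂ : Finset E}
    (hE : SharesOnlyVertex ends v E₁ E₂) (hs : ∀ e ∈ E₂, s ∉ ends e) (ht : ∀ e ∈ E₁, t ∉ ends e)
    (hsv : s ≠ v) (htv : t ≠ v) (hst : s ≠ t) (hd : Disjoint E₁ E₂) (k : ℕ) (ω : Config E) :
    ω ∈ genIn (fun S => SeparatesIn ends (E₁ ∪ E₂) S s t) (E₁ ∪ E₂) k ↔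
      ∃ j ≤ k, ω ∈ genIn (fun S => SeparatesIn ends E₁ S s v) E₁ j ∧
        ω ∈ genIn (fun S => SeparatesIn ends E₂ S v t) E₂ (k - j) := by
  have h1 : openSet ω ∩ (E₁ ∪ E₂) ∩ E₁ = openSet ω ∩ E₁ := by
    ext e; simp only [Finset.mem_inter, Finset.mem_union]; tauto
  have h2 : openSet ω ∩ (E₁ ∪ E₂) ∩ E₂ = openSet ω ∩ E₂ := by
    ext e; simp only [Finset.mem_inter, Finset.mem_union]; tauto
  simp only [genIn, Set.mem_setOf_eq]
  rw [kDisj_sep_ser_iff hE hs ht hsv htv hst hd k Finset.inter_subset_right, h1, h2]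

/-- **every network of the class has a log-concave cut tail** (for the vector `q = 1 − p`) -/
theorem CutNet.isLCTail {q : E → ℝ} (hq : IsProbVec q) {ends : E → Sym2 V} {s t : V} {E₀ : Finset E}
    (h : CutNet ends s t E₀) :
    IsLCTail (genTail q (fun S => SeparatesIn ends E₀ S s t) E₀) ((E₀.card : ℤ) + 1) := by
  induction h with
  | @atom s t E₁ hst hc h3 =>
    exact isLCTail_genTail_of_no_three hq (incr_separatesIn ends E₁ s t) (not_separatesIn_empty hc) E₁ h3
  | @par s t E₁ E₂ hst hE hd _ _ ih₁ ih₂ =>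
    exact isLCTail_genTail_min q (A := fun S => SeparatesIn ends (E₁ ∪ E₂) S s t)
      (A₁ := fun S => SeparatesIn ends E₁ S s t) (A₂ := fun S => SeparatesIn ends E₂ S s t) hd
      (genIn_sep_par_iff hst hE hd) ih₁ ih₂
  | @ser s v t E₁ E₂ hE hs ht hsv htv hst hd h₁ h₂ ih₁ ih₂ =>
    have h0 : ¬ (fun S => SeparatesIn ends (E₁ ∪ E₂) S s t) (∅ : Finset E) :=
      not_separatesIn_empty (carries_union_trans h₁.carries h₂.carries)
    have h10 : ¬ (fun S => SeparatesIn ends E₁ S s v) (∅ : Finset E) := not_separatesIn_empty h₁.carries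
    exact isLCTail_genTail_sum q (A := fun S => SeparatesIn ends (E₁ ∪ E₂) S s t)
      (A₁ := fun S => SeparatesIn ends E₁ S s v) (A₂ := fun S => SeparatesIn ends E₂ S v t) h0 h10 hd
      (genIn_sep_ser_iff hE hs ht hsv htv hst hd) ih₁ ih₂

/-- row B2* inside a network of the class, at every level -/
theorem CutNet.cutIn_logconcave {p : E → ℝ} (hp : IsProbVec p) {ends : E → Sym2 V} {s t : V}
    {E₀ : Finset E} (h : CutNet ends s t E₀) (k : ℕ) :
    prob p (cutIn ends s t E₀ k) * prob p (cutIn ends s t E₀ (k + 2))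
      ≤ prob p (cutIn ends s t E₀ (k + 1)) * prob p (cutIn ends s t E₀ (k + 1)) := by
  rw [prob_cutIn, prob_cutIn, prob_cutIn]
  exact genIn_logconcave_of_isLCTail (h.isLCTail (isProbVec_one_sub hp)) k

/-- **Row B2* on every series–parallel composition of blocks of terminal distance ≤ 2**: if the
whole edge set is a network of the class, then `P(D ≥ k)·P(D ≥ k+2) ≤ P(D ≥ k+1)²` for every
product measure and every `k` (`D` = the distance to the connection event = the packing number of
the closed cuts, `cutEvent`). -/
theorem cut_logconcave_of_CutNet {p : E → ℝ} (hp : IsProbVec p) {ends : E → Sym2 V} {s t : V}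
    (h : CutNet ends s t Finset.univ) (k : ℕ) :
    prob p (cutEvent ends s t k) * prob p (cutEvent ends s t (k + 2))
      ≤ prob p (cutEvent ends s t (k + 1)) * prob p (cutEvent ends s t (k + 1)) := by
  rw [← cutIn_univ, ← cutIn_univ, ← cutIn_univ]
  exact h.cutIn_logconcave hp k

end Summit.Ventures.PercRepro2
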